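import Literature.NumberTheory.Automorphic.HilbertRepIsotypicSubrepresentations
import Literature.NumberTheory.Automorphic.SmoothRepresentation
import HarnessLib

/-!
# Occurrence of an irreducible representation in a unitary representation, occurrence at a
# level `K`, irreducible constituents of a closed invariant subspace, and pure isotypic type on
# a subgroup
(Dixmier, *C\*-algebras* (1977), §5.4, §13.1; Deitmar–Echterhoff, *Principles of Harmonic
Analysis* (2014), §7.3; Borel–Jacquet, *Automorphic forms and automorphic representations*,
Corvallis (1979), §4.6)

Topic `NumberTheory/Automorphic`; definitions and theorems, no named fact, no instance,
continuing `HilbertRepIsotypicComponent` / `HilbertRepIsotypicSubrepresentations`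
(`isotypicMembers`, `isotypicComponent`, `weightSpace`) for a representation `π` of a group `G`
on a complex Hilbert space `H` and a representation `σ` on a Hilbert space `H'`.

This is the vocabulary in which "the automorphic representation `σ` occurs (discretely) in
`L²(G(F)\G(𝔸))` with multiplicity `m(σ)` and has non-zero `K_f`-fixed vectors" — the right-hand
side `⊕_σ m(σ) σ_f^{K_f}` of Matsushima-type formulas — and "every irreducible constituent of
the closure of a space of automorphic forms lies in a prescribed class" are stated, for an
arbitrary group `G` and subgroup `K ≤ G`:

* `π.OccursIn σ` — some topologically irreducible closed subrepresentation of `π` is unitarily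
  equivalent to `σ` (Dixmier §5.4: `σ` is contained in `π`); `occursIn_iff_isotypicComponent_ne_bot`
  (the `σ`-isotypic component is non-zero), `occursIn_iff_multiplicity_ne_zero` (the tree's
  `multiplicity π σ`, Dixmier 5.4.6, is `≠ 0`), `occursIn_congr`.
* `π.OccursInAtLevel σ K` — a member `W ≃ σ` of the class contains a non-zero `K`-fixed vector
  (Borel–Jacquet §4.6: `σ^{K} ≠ 0` for an automorphic `σ` occurring in `L²`);
  `occursInAtLevel_iff` : **`⟺ π.OccursIn σ ∧ σ^K ≠ 0`** (transport of fixed vectors along the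
  unitary equivalence — no unitarity of `π` needed), and for unitary `π`
  `occursInAtLevel_iff_inf_ne_bot` : **`⟺ H_σ ∩ H^K ≠ 0`** (the orthogonal projection onto a
  member commutes with `π(K)`, `IsUnitary.starProjection_map_eq`, so it maps a `K`-fixed vector of
  the component `H_σ` not orthogonal to that member to a non-zero `K`-fixed vector inside it).
* `π.closedSpan S` — the smallest closed `π(G)`-invariant subspace containing a set `S ⊆ H`
  (the closure of the span of the orbit `π(G) S`); `subset_closedSpan`, `closedSpan_le`,
  `closedSpan_eq_topologicalClosure_span` when `span S` is already invariant.
* `π.IsConstituent M σ` for a closed invariant subspace `M` — a member `W ≃ σ` lies inside `M`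
  (an *irreducible constituent of `M`* in the discrete sense); for unitary `π`,
  `isConstituent_iff_inf_ne_bot` : `⟺ M ∩ H_σ ≠ 0` (`exists_isotypicMember_le`).
  `π.AllConstituentsIn M 𝒜` — every irreducible closed subrepresentation of `π` inside `M`
  belongs to the class `𝒜 : Set (ClosedSubrep π)`; antitone in `M`, monotone in `𝒜`.
* `π.HasPureType φ τ` for a group homomorphism `φ : G' →* G` and a representation `τ` of `G'` —
  the restriction `π|_{G'}` (Mathlib `ContRepresentation.restrict`) is purely `τ`-isotypic:
  its `τ`-isotypic component is everything. For `G = G_∞ × G_f` and `φ` the inclusion of `G_∞`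
  this TYPES "the archimedean component of `π` is `τ`" without a tensor-product decomposition
  `π ≅ π_∞ ⊗ π_f` (for an irreducible unitary `π` of a product with `π ≅ π_∞ ⊗̂ π_f`, the
  restriction to `G_∞` is `π_∞ ⊗̂ 1 ≅ π_∞^{⊕ dim π_f}`, purely `π_∞`-isotypic; Deitmar–Echterhoff
  §7.5). `hasPureType_congr`: invariance under unitary equivalence of `τ`.
  `π.pureTypeClass φ τ : Set (ClosedSubrep π)` — the irreducible closed subrepresentations of `π`
  of pure type `τ` on `G'` (e.g. the class `𝒜^{1,0}` of irreducible `σ ⊂ L²([G])` with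
  prescribed archimedean component).

## Mathlib / tree

Mathlib (pinned) has `ContRepresentation` with `restrict`, `invariants`, `Equiv`;
`Submodule.starProjection` with `starProjection_apply_eq_zero_iff`, `Submodule.iInf_orthogonal`,
`Submodule.orthogonal_closure`, `Submodule.inf_orthogonal_eq_bot`. The tree supplies
`Representation.fixedPoints` (`SmoothRepresentation`; the `K`-fixed vectors `V^K`, also used by
`AutomorphicSpectrum.fixedVectors` and `HeckeAlgebra.heckeOperator`), `ClosedSubrep`,
`IsTopIrreducible`, `AreUnitarilyEquivalent`, `multiplicity` (`HilbertRepSpectrum`),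
`isotypicMembers` / `isotypicComponent` (`HilbertRepIsotypicComponent`), `weightSpace`,
`exists_isotypicMember_le` (`HilbertRepIsotypicSubrepresentations`),
`le_multiplicity_of_pairwise_isOrtho` (`HilbertRepOrthogonalDecomposition`). Nothing is
duplicated: every declaration below is new vocabulary or a lemma about it.

## Design notes

* As in the files it continues, the declarations are DELIBERATE dot-notation extensions in
  `namespace ContRepresentation` (`π.OccursIn σ`, `π.OccursInAtLevel σ K`, `π.closedSpan S`,
  `π.IsConstituent M σ`, `π.AllConstituentsIn M 𝒜`, `π.HasPureType φ τ`, `π.pureTypeClass φ τ`);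
  nothing else enters a Mathlib namespace.
* `K`-fixed vectors are `π.toRepresentation.fixedPoints K` (tree `Representation.fixedPoints`),
  identified with the weight space of the family `K → G` for the weight `1`
  (`fixedPoints_toRepresentation_eq_weightSpace`) so that the transport lemmas of
  `HilbertRepIsotypicSubrepresentations` apply verbatim.
* "Occurs" is the DISCRETE notion (a closed irreducible subrepresentation), the one relevant for
  `L²` of a compact quotient; weak containment is not considered.
* Provenance. Generic layer written for the model-construction sub-cell of the adjudication of
  the 2001 Hodge/CM manuscripts (their Def. 3.2 "every irreducible constituent of the
  `L²`-closure of the theta space lies in `𝒜^{1,0}`" and "`π_∞ ≅ J ⊗ 1`" are INSTANCES of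
  `AllConstituentsIn` / `pureTypeClass`); nothing here is a claim of those manuscripts — every
  statement is standard unitary representation theory with the citations given.

## References

* J. Dixmier, *C\*-algebras*, North-Holland (1977), §5.4 (5.4.6 multiplicity), §13.1
  [Dixmier1977].
* A. Deitmar, S. Echterhoff, *Principles of Harmonic Analysis*, 2nd ed., Universitext, Springer
  (2014), §7.3 *Isotypes* (Thm. 7.3.2), §7.5 (representations of products) [DeitmarEchterhoff2014].
* A. Borel, H. Jacquet, *Automorphic forms and automorphic representations*, Proc. Sympos. Pure
  Math. 33.1 (1979), §4.6 [BorelJacquet1979].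
-/

noncomputable section

open scoped InnerProductSpace
open Topology

namespace ContRepresentation

/-! ### Fixed vectors of a continuous representation as a weight space -/

section Fixed

variable {G H : Type*} [Group G] [NormedAddCommGroup H] [InnerProductSpace ℂ H]
  (π : ContRepresentation ℂ G H) (K : Subgroup G)

/-- Membership in the `K`-fixed vectors `H^K = π.toRepresentation.fixedPoints K`:
`π k v = v` for all `k ∈ K` (Borel–Jacquet (1979), §4.6). [cite: BorelJacquet1979, §4.6] -/
theorem mem_fixedPoints_toRepresentation (v : H) :
    v ∈ π.toRepresentation.fixedPoints K ↔ ∀ g ∈ K, π g v = v :=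
  π.toRepresentation.mem_fixedPoints K v

/-- The `K`-fixed vectors are the weight space of the family `K → G` for the weight `1`.
[folklore] -/
theorem fixedPoints_toRepresentation_eq_weightSpace :
    π.toRepresentation.fixedPoints K = π.weightSpace (fun k : K => (k : G)) (fun _ => (1 : ℂ)) := by
  ext v
  rw [mem_fixedPoints_toRepresentation, mem_weightSpace]
  simp only [one_smul, Subtype.forall]

/-- The `K`-fixed vectors form a closed subspace. [folklore] -/
theorem isClosed_fixedPoints_toRepresentation :
    IsClosed (π.toRepresentation.fixedPoints K : Set H) := by
  rw [fixedPoints_toRepresentation_eq_weightSpace]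
  exact isClosed_weightSpace

/-- `K ↦ H^K` is antitone. [folklore] -/
theorem fixedPoints_toRepresentation_antitone :
    Antitone fun K : Subgroup G => π.toRepresentation.fixedPoints K :=
  π.toRepresentation.fixedPoints_antitone

end Fixed

/-! ### Occurrence -/

section Occurrence

variable {G H H' H'' : Type*} [Group G]
  [NormedAddCommGroup H] [InnerProductSpace ℂ H]
  [NormedAddCommGroup H'] [InnerProductSpace ℂ H']
  [NormedAddCommGroup H''] [InnerProductSpace ℂ H'']
  {π : ContRepresentation ℂ G H} {σ : ContRepresentation ℂ G H'}

/-- `σ` **occurs in** `π` (discretely): some topologically irreducible closed subrepresentation of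
`π` is unitarily equivalent to `σ`, i.e. the class of `σ` has a member in `π`
(Dixmier (1977), §5.4; Deitmar–Echterhoff (2014), §7.3). [cite: Dixmier1977, §5.4] -/
def OccursIn (π : ContRepresentation ℂ G H) (σ : ContRepresentation ℂ G H') : Prop :=
  (π.isotypicMembers σ).Nonempty

/-- `σ` **occurs in `π` at level `K`**: some member `W ≃ σ` of the class contains a non-zero
`K`-fixed vector — for `π = L²(G(F)\G(𝔸))` and `K = K_f` a level subgroup this is
"`σ` is automorphic with `σ^{K_f} ≠ 0`" (Borel–Jacquet (1979), §4.6). [cite: BorelJacquet1979, §4.6] -/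
def OccursInAtLevel (π : ContRepresentation ℂ G H) (σ : ContRepresentation ℂ G H')
    (K : Subgroup G) : Prop :=
  ∃ W ∈ π.isotypicMembers σ, ∃ v ∈ W, v ≠ 0 ∧ v ∈ π.toRepresentation.fixedPoints K

/-- Unfolding `OccursIn`. [folklore] -/
theorem occursIn_iff :
    π.OccursIn σ ↔
      ∃ W : ClosedSubrep π, W.toContRep.IsTopIrreducible ∧ AreUnitarilyEquivalent W.toContRep σ :=
  Iff.rfl

/-- Occurrence depends on `σ` only up to unitary equivalence. [folklore] -/
theorem occursIn_congr {σ' : ContRepresentation ℂ G H''} (h : AreUnitarilyEquivalent σ σ') :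
    π.OccursIn σ ↔ π.OccursIn σ' := by
  rw [OccursIn, OccursIn, isotypicMembers_congr h]

/-- If `σ` occurs in `π`, its isotypic component is non-zero. [cite: Dixmier1977, §5.4] -/
theorem OccursIn.isotypicComponent_ne_bot (h : π.OccursIn σ) : π.isotypicComponent σ ≠ ⊥ := by
  obtain ⟨W, hW⟩ := h
  intro hbot
  exact ClosedSubrep.ne_bot_of_isTopIrreducible hW.1
    (le_bot_iff.mp ((le_isotypicComponent hW.1 hW.2).trans hbot.le))

/-- If `σ` does not occur in `π`, its isotypic component vanishes (it is the closed span of the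
empty family). [cite: Dixmier1977, §5.4] -/
theorem isotypicComponent_eq_bot_of_not_occursIn (h : ¬ π.OccursIn σ) :
    π.isotypicComponent σ = ⊥ :=
  le_antisymm (isotypicComponent_le fun W hW he => absurd ⟨W, ⟨hW, he⟩⟩ h) bot_le

/-- **`σ` occurs in `π` iff the `σ`-isotypic component of `π` is non-zero.**
[cite: Dixmier1977, §5.4] -/
theorem occursIn_iff_isotypicComponent_ne_bot : π.OccursIn σ ↔ π.isotypicComponent σ ≠ ⊥ :=
  ⟨OccursIn.isotypicComponent_ne_bot,
    fun h => Classical.byContradiction fun h' => h (isotypicComponent_eq_bot_of_not_occursIn h')⟩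

/-- If `σ` occurs in `π` then `multiplicity π σ ≥ 1`. [cite: Dixmier1977, 5.4.6] -/
theorem OccursIn.one_le_multiplicity (h : π.OccursIn σ) : 1 ≤ π.multiplicity σ := by
  obtain ⟨W, hW⟩ := h
  have key := le_multiplicity_of_pairwise_isOrtho (π := π) (W := fun _ : Unit => W)
    (fun _ => hW.1) (fun i j hij => absurd (Subsingleton.elim i j) hij)
    (σ := σ) (Finset.univ : Finset Unit) (fun _ _ => hW.2)
  simpa using key

/-- If `multiplicity π σ ≠ 0` then `σ` occurs in `π`. [cite: Dixmier1977, 5.4.6] -/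
theorem occursIn_of_multiplicity_ne_zero (h : π.multiplicity σ ≠ 0) : π.OccursIn σ := by
  by_contra hno
  apply h
  simp only [multiplicity, ENat.iSup_eq_zero, Nat.cast_eq_zero, Finset.card_eq_zero]
  intro s hs _
  exact Finset.eq_empty_of_forall_notMem fun W hW => hno ⟨W, hs W hW⟩

/-- **`σ` occurs in `π` iff `multiplicity π σ ≠ 0`.** [cite: Dixmier1977, 5.4.6] -/
theorem occursIn_iff_multiplicity_ne_zero : π.OccursIn σ ↔ π.multiplicity σ ≠ 0 := by
  refine ⟨fun h h0 => ?_, occursIn_of_multiplicity_ne_zero⟩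
  have h1 := h.one_le_multiplicity
  rw [h0] at h1
  exact absurd h1 (by norm_num)

/-! ### Occurrence at a level -/

/-- Occurrence at level `K` implies occurrence. [folklore] -/
theorem OccursInAtLevel.occursIn {K : Subgroup G} (h : π.OccursInAtLevel σ K) : π.OccursIn σ := by
  obtain ⟨W, hW, -⟩ := h
  exact ⟨W, hW⟩

/-- Occurrence at level is antitone in the level: a smaller subgroup fixes more vectors.
[folklore] -/
theorem OccursInAtLevel.anti {K K' : Subgroup G} (hKK' : K ≤ K') (h : π.OccursInAtLevel σ K') :
    π.OccursInAtLevel σ K := by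
  obtain ⟨W, hW, v, hvW, hv0, hv⟩ := h
  exact ⟨W, hW, v, hvW, hv0, π.toRepresentation.fixedPoints_antitone hKK' hv⟩

/-- **Transport of fixed vectors along the class.** A member `W ≃ σ` of the class of `σ` in `π`
contains a non-zero `K`-fixed vector iff `σ` has a non-zero `K`-fixed vector (the unitary
equivalence is an injective intertwiner). [folklore] -/
theorem exists_mem_fixedPoints_iff_of_mem_isotypicMembers {W : ClosedSubrep π}
    (hW : W ∈ π.isotypicMembers σ) (K : Subgroup G) :
    (∃ v ∈ W, v ≠ 0 ∧ v ∈ π.toRepresentation.fixedPoints K) ↔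
      σ.toRepresentation.fixedPoints K ≠ ⊥ := by
  obtain ⟨e, -⟩ := hW.2
  rw [Submodule.ne_bot_iff, fixedPoints_toRepresentation_eq_weightSpace]
  simp only [fixedPoints_toRepresentation_eq_weightSpace]
  constructor
  · rintro ⟨v, hvW, hv0, hv⟩
    have hv' : (⟨v, hvW⟩ : W.toSubmodule) ∈
        W.toContRep.weightSpace (fun k : K => (k : G)) (fun _ => (1 : ℂ)) :=
      (ClosedSubrep.mem_weightSpace_toContRep W).mpr hv
    refine ⟨e ⟨v, hvW⟩, (mem_weightSpace_equiv e).mpr hv', fun h0 => hv0 ?_⟩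
    have h1 : e (⟨v, hvW⟩ : W.toSubmodule) = e 0 := by rw [map_zero]; exact h0
    have : (⟨v, hvW⟩ : W.toSubmodule) = 0 := e.injective h1
    exact congrArg Subtype.val this
  · rintro ⟨x, hx, hx0⟩
    have hx' : e.symm x ∈ W.toContRep.weightSpace (fun k : K => (k : G)) (fun _ => (1 : ℂ)) :=
      (mem_weightSpace_equiv e.symm).mpr hx
    refine ⟨(e.symm x : H), (e.symm x).2, fun h0 => hx0 ?_,
      (ClosedSubrep.mem_weightSpace_toContRep W).mp hx'⟩
    have h1 : e.symm x = 0 := Subtype.ext h0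
    simpa using congrArg e h1

/-- **Occurrence at level `K` ⟺ occurrence ∧ `σ^K ≠ 0`.** [cite: BorelJacquet1979, §4.6] -/
theorem occursInAtLevel_iff (K : Subgroup G) :
    π.OccursInAtLevel σ K ↔ π.OccursIn σ ∧ σ.toRepresentation.fixedPoints K ≠ ⊥ := by
  constructor
  · rintro ⟨W, hW, hv⟩
    exact ⟨⟨W, hW⟩, (exists_mem_fixedPoints_iff_of_mem_isotypicMembers hW K).mp hv⟩
  · rintro ⟨⟨W, hW⟩, hσ⟩
    exact ⟨W, hW, (exists_mem_fixedPoints_iff_of_mem_isotypicMembers hW K).mpr hσ⟩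

/-- Occurrence at level `K` gives a non-zero `K`-fixed vector in the isotypic component.
[folklore] -/
theorem OccursInAtLevel.inf_ne_bot {K : Subgroup G} (h : π.OccursInAtLevel σ K) :
    (π.isotypicComponent σ).toSubmodule ⊓ π.toRepresentation.fixedPoints K ≠ ⊥ := by
  obtain ⟨W, hW, v, hvW, hv0, hv⟩ := h
  rw [Submodule.ne_bot_iff]
  exact ⟨v, ⟨le_isotypicComponent hW.1 hW.2 hvW, hv⟩, hv0⟩

/-- **For unitary `π`: `σ` occurs at level `K` iff the `σ`-isotypic component contains a non-zero
`K`-fixed vector, `H_σ ∩ H^K ≠ 0`.** A non-zero `K`-fixed `v ∈ H_σ` is not orthogonal to every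
member of the class (else it would be orthogonal to their closed span `H_σ ∋ v`); for a member
`W` with `P_W v ≠ 0`, the orthogonal projection `P_W` commutes with `π(K)` (`W` is closed and
invariant, `π` unitary: `IsUnitary.starProjection_map_eq`), so `P_W v` is a non-zero `K`-fixed
vector in `W` (Deitmar–Echterhoff (2014), §7.3; Borel–Jacquet (1979), §4.6). [cite: BorelJacquet1979, §4.6] -/
theorem occursInAtLevel_iff_inf_ne_bot [CompleteSpace H] (hπ : π.IsUnitary) (K : Subgroup G) :
    π.OccursInAtLevel σ K ↔
      (π.isotypicComponent σ).toSubmodule ⊓ π.toRepresentation.fixedPoints K ≠ ⊥ := by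
  refine ⟨OccursInAtLevel.inf_ne_bot, fun h => ?_⟩
  obtain ⟨v, hv, hv0⟩ := Submodule.ne_bot_iff _ |>.mp h
  obtain ⟨hvN, hvK⟩ := Submodule.mem_inf.mp hv
  -- some member `W` is not orthogonal to `v`
  have hW : ∃ W ∈ π.isotypicMembers σ, W.toSubmodule.starProjection v ≠ 0 := by
    by_contra hall
    push Not at hall
    apply hv0
    have hvorth : v ∈ (⨆ W ∈ π.isotypicMembers σ, (W : ClosedSubrep π).toSubmodule)ᗮ := by
      rw [← iSup_subtype'', ← Submodule.iInf_orthogonal]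
      refine Submodule.mem_iInf _ |>.mpr fun W => ?_
      exact (Submodule.starProjection_apply_eq_zero_iff _).mp (hall W.1 W.2)
    have hvN' : v ∈ (⨆ W ∈ π.isotypicMembers σ, (W : ClosedSubrep π).toSubmodule).topologicalClosure := by
      rw [← toSubmodule_isotypicComponent]
      exact hvN
    rw [← Submodule.orthogonal_closure] at hvorth
    have hmem := Submodule.mem_inf.mpr ⟨hvN', hvorth⟩
    rw [Submodule.inf_orthogonal_eq_bot, Submodule.mem_bot] at hmem
    exact hmem
  obtain ⟨W, hWm, hPv⟩ := hW
  have hWinv : ∀ g : G, ∀ w ∈ W.toSubmodule, π g w ∈ W.toSubmodule := fun g w hw => W.apply_mem g hw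
  refine ⟨W, hWm, W.toSubmodule.starProjection v, W.toSubmodule.starProjection_apply_mem v, hPv, ?_⟩
  rw [mem_fixedPoints_toRepresentation] at hvK ⊢
  intro k hk
  rw [← hπ.starProjection_map_eq hWinv k v, hvK k hk]

/-! ### The closed invariant subspace generated by a set; irreducible constituents -/

variable (π)

/-- The **closed `π(G)`-invariant subspace generated by `S`**: the closure of the span of the orbit
`⋃_g π(g) S` — the smallest closed subrepresentation containing `S` (`closedSpan_le`)
(Dixmier (1977), §13.1.2). [cite: Dixmier1977, §13.1.2] -/
def closedSpan (S : Set H) : ClosedSubrep π :=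
  ClosedSubrep.ofSubmodule (Submodule.span ℂ (⋃ g : G, π g '' S)).topologicalClosure
    (Submodule.isClosed_topologicalClosure _)
    (by
      intro g v hv
      have hstab : ∀ w ∈ Submodule.span ℂ (⋃ g' : G, π g' '' S),
          π g w ∈ Submodule.span ℂ (⋃ g' : G, π g' '' S) := by
        intro w hw
        refine Submodule.span_induction (p := fun w _ => π g w ∈ Submodule.span ℂ (⋃ g' : G, π g' '' S))
          ?_ ?_ ?_ ?_ hw
        · intro x hx
          obtain ⟨g', hx'⟩ := Set.mem_iUnion.mp hx
          obtain ⟨s, hs, rfl⟩ := hx'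
          refine Submodule.subset_span (Set.mem_iUnion.mpr ⟨g * g', ⟨s, hs, ?_⟩⟩)
          rw [map_mul]
          rfl
        · simp
        · intro x y _ _ hx hy
          rw [map_add]
          exact Submodule.add_mem _ hx hy
        · intro c x _ hx
          rw [map_smul]
          exact Submodule.smul_mem _ c hx
      have hcont : Continuous (π g) := (π g).continuous
      have himage : (π g) '' (Submodule.span ℂ (⋃ g' : G, π g' '' S) : Set H) ⊆
          Submodule.span ℂ (⋃ g' : G, π g' '' S) := by
        rintro _ ⟨w, hw, rfl⟩
        exact hstab w hw
      have := image_closure_subset_closure_image hcont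
        (s := (Submodule.span ℂ (⋃ g' : G, π g' '' S) : Set H)) ⟨v, hv, rfl⟩
      exact closure_mono himage this)

variable {π}

/-- `S` is contained in the closed invariant subspace it generates. [folklore] -/
theorem subset_closedSpan (S : Set H) : S ⊆ π.closedSpan S := by
  intro s hs
  refine Submodule.le_topologicalClosure _ (Submodule.subset_span ?_)
  exact Set.mem_iUnion.mpr ⟨1, ⟨s, hs, by rw [map_one]; rfl⟩⟩

/-- The closed invariant subspace generated by `S` is below every closed subrepresentation
containing `S`. [cite: Dixmier1977, §13.1.2] -/
theorem closedSpan_le {S : Set H} {M : ClosedSubrep π} (h : S ⊆ M) : π.closedSpan S ≤ M := by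
  intro v hv
  have hle : Submodule.span ℂ (⋃ g : G, π g '' S) ≤ M.toSubmodule := by
    refine Submodule.span_le.mpr ?_
    intro x hx
    obtain ⟨g, hx'⟩ := Set.mem_iUnion.mp hx
    obtain ⟨s, hs, rfl⟩ := hx'
    exact M.apply_mem g (h hs)
  exact (Submodule.topologicalClosure_minimal _ hle M.isClosed) hv

/-- `closedSpan` is monotone. [folklore] -/
theorem closedSpan_mono {S S' : Set H} (h : S ⊆ S') : π.closedSpan S ≤ π.closedSpan S' :=
  closedSpan_le (h.trans (subset_closedSpan S'))

/-- If the span of `S` is already `π(G)`-invariant, the closed invariant subspace generated by `S`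
is just the closure of the span (e.g. `S` a `G`-stable space of automorphic forms: its
`L²`-closure). [folklore] -/
theorem closedSpan_eq_topologicalClosure_span {S : Set H}
    (hS : ∀ g : G, ∀ v ∈ Submodule.span ℂ S, π g v ∈ Submodule.span ℂ S) :
    (π.closedSpan S).toSubmodule = (Submodule.span ℂ S).topologicalClosure := by
  apply le_antisymm
  · have hM : S ⊆ (ClosedSubrep.ofSubmodule (π := π) (Submodule.span ℂ S).topologicalClosure
        (Submodule.isClosed_topologicalClosure _)
        (by
          intro g v hv
          have himage : (π g) '' (Submodule.span ℂ S : Set H) ⊆ Submodule.span ℂ S := by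
            rintro _ ⟨w, hw, rfl⟩
            exact hS g w hw
          exact closure_mono himage
            (image_closure_subset_closure_image (π g).continuous ⟨v, hv, rfl⟩)) : Set H) :=
      fun s hs => Submodule.le_topologicalClosure _ (Submodule.subset_span hs)
    exact closedSpan_le hM
  · exact Submodule.topologicalClosure_minimal _
      ((Submodule.span_mono (subset_closedSpan S)).trans (Submodule.span_le.mpr le_rfl))
      (π.closedSpan S).isClosed

variable (π)

/-- `σ` is an **irreducible constituent** of the closed invariant subspace `M` (discrete sense):
some member `W ≃ σ` of the class of `σ` lies inside `M` (Dixmier (1977), §5.4).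
[cite: Dixmier1977, §5.4] -/
def IsConstituent (M : ClosedSubrep π) (σ : ContRepresentation ℂ G H') : Prop :=
  ∃ W ∈ π.isotypicMembers σ, W ≤ M

/-- **Every irreducible constituent of `M` lies in the class `𝒜`**: every topologically
irreducible closed subrepresentation of `π` contained in `M` belongs to `𝒜 : Set (ClosedSubrep π)`
(the shape of "every irreducible constituent of the `L²`-closure lies in `𝒜^{1,0}`").
[cite: Dixmier1977, §5.4] -/
def AllConstituentsIn (M : ClosedSubrep π) (𝒜 : Set (ClosedSubrep π)) : Prop :=
  ∀ W : ClosedSubrep π, W.toContRep.IsTopIrreducible → W ≤ M → W ∈ 𝒜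

variable {π}

/-- `σ` is a constituent of `⊤` iff it occurs. [folklore] -/
theorem isConstituent_top_iff : π.IsConstituent ⊤ σ ↔ π.OccursIn σ :=
  ⟨fun ⟨W, hW, _⟩ => ⟨W, hW⟩, fun ⟨W, hW⟩ => ⟨W, hW, le_top⟩⟩

/-- A constituent of `M` is a constituent of every larger closed invariant subspace. [folklore] -/
theorem IsConstituent.mono {M M' : ClosedSubrep π} (hMM' : M ≤ M') (h : π.IsConstituent M σ) :
    π.IsConstituent M' σ := by
  obtain ⟨W, hW, hle⟩ := h
  exact ⟨W, hW, hle.trans hMM'⟩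

/-- A constituent of `M` occurs in `π`. [folklore] -/
theorem IsConstituent.occursIn {M : ClosedSubrep π} (h : π.IsConstituent M σ) : π.OccursIn σ :=
  isConstituent_top_iff.mp (h.mono le_top)

/-- A constituent meets the isotypic component: `M ∩ H_σ ≠ 0`. [folklore] -/
theorem IsConstituent.inf_ne_bot {M : ClosedSubrep π} (h : π.IsConstituent M σ) :
    M.toSubmodule ⊓ (π.isotypicComponent σ).toSubmodule ≠ ⊥ := by
  obtain ⟨W, hW, hle⟩ := h
  obtain ⟨v, hv, hv0⟩ := ClosedSubrep.exists_mem_ne_zero_of_isTopIrreducible hW.1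
  rw [Submodule.ne_bot_iff]
  exact ⟨v, ⟨hle hv, le_isotypicComponent hW.1 hW.2 hv⟩, hv0⟩

/-- **For unitary `π`: `σ` is a constituent of `M` iff `M ∩ H_σ ≠ 0`** (a non-zero closed invariant
subspace of the isotypic component contains a member of the class,
`exists_isotypicMember_le`). [cite: DeitmarEchterhoff2014, Cor. 6.1.9] -/
theorem isConstituent_iff_inf_ne_bot [CompleteSpace H] (hπ : π.IsUnitary) (M : ClosedSubrep π) :
    π.IsConstituent M σ ↔ M.toSubmodule ⊓ (π.isotypicComponent σ).toSubmodule ≠ ⊥ := by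
  refine ⟨IsConstituent.inf_ne_bot, fun h => ?_⟩
  set N : ClosedSubrep π := ClosedSubrep.ofSubmodule
    (M.toSubmodule ⊓ (π.isotypicComponent σ).toSubmodule)
    (by
      rw [Submodule.coe_inf]
      exact M.isClosed.inter (π.isotypicComponent σ).isClosed)
    (fun g v hv => ⟨M.apply_mem g hv.1, (π.isotypicComponent σ).apply_mem g hv.2⟩) with hNdef
  have hNle : N ≤ π.isotypicComponent σ := fun v hv => hv.2
  have hN0 : N ≠ ⊥ := by
    intro hN
    apply h
    rw [Submodule.eq_bot_iff]
    intro v hv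
    have hv' : v ∈ N := hv
    rw [hN, ClosedSubrep.mem_bot] at hv'
    exact hv'
  obtain ⟨W, hW, hWN⟩ := exists_isotypicMember_le hπ hNle hN0
  exact ⟨W, hW, fun v hv => (hWN hv).1⟩

/-- `AllConstituentsIn` is antitone in the subspace. [folklore] -/
theorem AllConstituentsIn.anti {M M' : ClosedSubrep π} {𝒜 : Set (ClosedSubrep π)} (hMM' : M ≤ M')
    (h : π.AllConstituentsIn M' 𝒜) : π.AllConstituentsIn M 𝒜 :=
  fun W hW hle => h W hW (hle.trans hMM')

/-- `AllConstituentsIn` is monotone in the class. [folklore] -/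
theorem AllConstituentsIn.mono {M : ClosedSubrep π} {𝒜 𝒜' : Set (ClosedSubrep π)} (h𝒜 : 𝒜 ⊆ 𝒜')
    (h : π.AllConstituentsIn M 𝒜) : π.AllConstituentsIn M 𝒜' :=
  fun W hW hle => h𝒜 (h W hW hle)

/-- If every constituent of `M` lies in `𝒜` and `σ` is a constituent of `M`, then some member of
the class of `σ` inside `M` belongs to `𝒜`. [folklore] -/
theorem AllConstituentsIn.exists_mem {M : ClosedSubrep π} {𝒜 : Set (ClosedSubrep π)}
    (h : π.AllConstituentsIn M 𝒜) (hσ : π.IsConstituent M σ) :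
    ∃ W ∈ π.isotypicMembers σ, W ≤ M ∧ W ∈ 𝒜 := by
  obtain ⟨W, hW, hle⟩ := hσ
  exact ⟨W, hW, hle, h W hW.1 hle⟩

end Occurrence

/-! ### Pure isotypic type on a subgroup -/

section PureType

variable {G G' H H' H'' : Type*} [Group G] [Group G']
  [NormedAddCommGroup H] [InnerProductSpace ℂ H]
  [NormedAddCommGroup H'] [InnerProductSpace ℂ H']
  [NormedAddCommGroup H''] [InnerProductSpace ℂ H'']
  {π : ContRepresentation ℂ G H} {φ : G' →* G} {τ : ContRepresentation ℂ G' H'}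

/-- `π` **has pure type `τ` on `G'`** (along `φ : G' →* G`): the restriction `π|_{G'}` is purely
`τ`-isotypic, i.e. its `τ`-isotypic component is the whole space. For `G = G_∞ × G_f`, `φ` the
inclusion of `G_∞` and `π` irreducible this types "`π_∞ ≅ τ`" (Deitmar–Echterhoff (2014), §7.3,
§7.5). [cite: DeitmarEchterhoff2014, §7.3] -/
def HasPureType (π : ContRepresentation ℂ G H) (φ : G' →* G) (τ : ContRepresentation ℂ G' H') :
    Prop :=
  (π.restrict φ).isotypicComponent τ = ⊤

/-- The **class of irreducible closed subrepresentations of `π` of pure type `τ` on `G'`** (e.g.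
`𝒜^{1,0} = {σ ⊂ L²([G]) irreducible | σ_∞ ≅ J}`). [cite: DeitmarEchterhoff2014, §7.3] -/
def pureTypeClass (π : ContRepresentation ℂ G H) (φ : G' →* G)
    (τ : ContRepresentation ℂ G' H') : Set (ClosedSubrep π) :=
  {W | W.toContRep.IsTopIrreducible ∧ W.toContRep.HasPureType φ τ}

/-- Unfolding membership in `pureTypeClass`. [folklore] -/
theorem mem_pureTypeClass_iff {W : ClosedSubrep π} :
    W ∈ π.pureTypeClass φ τ ↔ W.toContRep.IsTopIrreducible ∧ W.toContRep.HasPureType φ τ :=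
  Iff.rfl

/-- Pure type depends on `τ` only up to unitary equivalence. [folklore] -/
theorem hasPureType_congr {τ' : ContRepresentation ℂ G' H''} (h : AreUnitarilyEquivalent τ τ') :
    π.HasPureType φ τ ↔ π.HasPureType φ τ' := by
  rw [HasPureType, HasPureType, isotypicComponent_congr h]

/-- The class of pure type `τ` depends on `τ` only up to unitary equivalence. [folklore] -/
theorem pureTypeClass_congr {τ' : ContRepresentation ℂ G' H''} (h : AreUnitarilyEquivalent τ τ') :
    π.pureTypeClass φ τ = π.pureTypeClass φ τ' := by
  ext W
  rw [mem_pureTypeClass_iff, mem_pureTypeClass_iff, hasPureType_congr h]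

/-- If `π` has pure type `τ` on `G'` and `H ≠ 0`, then `τ` occurs in the restriction `π|_{G'}`.
[folklore] -/
theorem HasPureType.occursIn_restrict [Nontrivial H] (h : π.HasPureType φ τ) :
    (π.restrict φ).OccursIn τ := by
  rw [occursIn_iff_isotypicComponent_ne_bot, HasPureType] at *
  rw [h]
  intro htop
  obtain ⟨v, hv⟩ := exists_ne (0 : H)
  have : v ∈ (⊤ : ClosedSubrep (π.restrict φ)) := ClosedSubrep.mem_top v
  rw [htop, ClosedSubrep.mem_bot] at this
  exact hv this

end PureType

end ContRepresentation

end
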